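import Mathlib
import Summits.ValiantsHypothesis.ValiantsHypothesis.Theorems.GeneratorObstructionsPowGenDegreeQPGadgetTableauDefs

/-!
# Route GeneratorObstructions — crux K1 `PerGenDegreeSuperQP` (stmt-ValiantsHypothesis-11654), line
# `per-side-atoms`: the explicit PADDED gadget tableau datum (`k = 1`, `n₀ = 6`, strict `z`-tops)

Helper file (`--supports stmt-ValiantsHypothesis-11654`; blueprint: evidence memo
`evidence-11654-leafhand3-g7.md` on the item).  K1 is reduced (`perGenDegreeSuperQP_of_paddedGadgetGIT_one`,
file `…PaddedReductionFixed`) to ONE certificate: for every `c ≥ 2`, a highest-weight vector of nonconstant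
weight of `ℂ[Δ_{5c+1} p]` not vanishing at the padded doubling gadget
`p = x_z^{5(c-1)+1} Σ_{j<c} x_{B j} x_{A j}² x_{A' j}²` placed on the top `3c+1` matrix letters (`z` topmost).
This file DEFINES the tableau datum of the blueprint as an honest `TableauEval.TabM`
(`paddedTab c hc x`), with the index bookkeeping proved (`padBox_lt`: every box lands in the diagram):

* labels `u < d = 6(2^c-1)`: `u = 3v + ℓ`, block `j = log₂(v+2) - 1 < c`, copy `q = v + 2 - 2^{j+1}`
  (block `j` has `6·2^j` labels — TWO triples in block `0`); label `u` is label `u + 3` of the crux-K2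
  gadget tableau `gadgetTab 1 (c+1)` (its block `0` deleted, blocks renumbered);
* letters, largest first: row `0` = `z`, then the `3c` gadget letters `A'_{c-1}, A_{c-1}, A'_{c-2},
  B_{c-1}, A_{c-2}, …, A'_0, B_1, A_0, B_0` (rows `1 … 3c`); `var n r = x r` for an enumeration `x`;
* columns: `3·2^{c+1}` TALL columns `n = 3q + s` (height `3c+1` for `q ≤ 1`, `3c` for `q ∈ {2,3}`,
  `3c + 3 - 3 log₂ q` for `q ≥ 4`), then `d·(5c-8)` + `18·2^c - 24` singleton `z`-columns;
* boxes of label `u` (`m = 5c+1` of them): indices `s < 5` ↦ the gadget boxes of label `u+3` of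
  `gadgetTab 1 (c+1)` (`boxColRow 1 (c+1) (u+3) s`, row shifted by the `z`-row: `padRow`); `5 ≤ s < 9` ↦
  the four `z`-SLOTS (`zSlotCol`): the tops of block `j ≤ c-2` sit on the columns `q = v+2+2^{j+1}`,
  `q = v+2+2^{j+2}` (letter index `s = ℓ`) — a label of block `j` tops only columns whose other labels
  have blocks `≥ j+1` (STRICT tops) — block `0` additionally tops the full column `q = 1-v` (`s = ℓ`) and
  the type-`0` column `q = 2+v` (`s = 2-ℓ`, the block-`0` label missing from that column's pair); unused
  slots are dedicated singleton columns; `s ≥ 9` ↦ the main pool of singleton columns.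
A Python mirror (seat folder `calc/padded_design.py`, attached to the item) checks for `c ≤ 5` that this
is a column-strict filling of the doubling shape with the padded contents, and computes the signed count
`± 36^(2^{c+1}-4) · 2262816` (global check at `c = 2`).

Honest framing: definitions and index arithmetic; no stub, crux or summit is settled here;
`VP ≠ VNP` untouched. [folklore]
-/

namespace Summit.ValiantsHypothesis.ValiantsHypothesis.Theorems.GeneratorObstructions.PerGenDegreeSuperQP

open Literature.Computability.AlgebraicComplexity Literature.Computability.AlgebraicComplexity.TableauEval
open Summit.ValiantsHypothesis.ValiantsHypothesis.Theorems.GeneratorObstructions.PowGenDegreeQP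

-- `Summit.ValiantsHypothesis.ValiantsHypothesis.…` is the tree's mandated single-conjunct layout.
set_option linter.dupNamespace false

noncomputable section

/-! ## §1 Sizes -/

/-- Number of labels `d = 6(2^c - 1)`. [folklore] -/
def padD (c : ℕ) : ℕ := 6 * (2 ^ c - 1)

/-- Number of tall columns `3·2^{c+1}`. [folklore] -/
def padTall (c : ℕ) : ℕ := 3 * 2 ^ (c + 1)

/-- Size of the main singleton pool per label: `e - 4 = 5c - 8` (`e = 5(c-1)+1` letters `z` per label,
four of them in the `z`-slots). [folklore] -/
def padE4 (c : ℕ) : ℕ := 5 * c - 8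

/-- Number of labels of blocks `≤ c-2` (those with tops): `3(2^c - 2)`. [folklore] -/
def padD1 (c : ℕ) : ℕ := 3 * (2 ^ c - 2)

/-- Number of dedicated singleton columns (unused `z`-slots): `18·2^c - 24`. [folklore] -/
def padDed (c : ℕ) : ℕ := 18 * 2 ^ c - 24

/-- Total number of columns. [folklore] -/
def padC (c : ℕ) : ℕ := padTall c + padD c * padE4 c + padDed c

/-- Height of column `n`. [folklore] -/
def padHeight (c n : ℕ) : ℕ :=
  if n < padTall c then (if n / 3 < 2 then 3 * c + 1 else 3 * c + 3 - 3 * Nat.log 2 (n / 3)) else 1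

/-! ## §2 The box map -/

/-- Row of a gadget box: the row of `gadgetTab 1 (c+1)` shifted down by the `z`-row (its last row `3c`,
the letter `B_0`, closes the gap left by the deleted block). [folklore] -/
def padRow (c r : ℕ) : ℕ := (if r = 3 * c then 3 * c - 1 else r) + 1

/-- `2^{j+1}` for the label with `v = u / 3` (`v + 2 = 2^{j+1} + q`). [folklore] -/
def topPow (v : ℕ) : ℕ := 2 ^ Nat.log 2 (v + 2)

/-- Index of an unused `z`-slot among the dedicated singleton columns. [folklore] -/
def dedIdx (c u i : ℕ) : ℕ :=
  if u < padD1 c then 2 * (u - 6) + (i - 2) else 2 * (padD1 c - 6) + 4 * (u - padD1 c) + i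

/-- Column of the `i`-th `z`-slot (`i < 4`) of label `u`. [folklore] -/
def zSlotCol (c u i : ℕ) : ℕ :=
  if i = 0 ∧ u < padD1 c then 3 * (u / 3 + 2 + topPow (u / 3)) + u % 3
  else if i = 1 ∧ u < padD1 c then 3 * (u / 3 + 2 + 2 * topPow (u / 3)) + u % 3
  else if i = 2 ∧ u < 6 then 3 * (1 - u / 3) + u % 3
  else if i = 3 ∧ u < 6 then 3 * (2 + u / 3) + (2 - u % 3)
  else padTall c + padD c * padE4 c + dedIdx c u i

/-- Column and row of the `s`-th box of label `u` (as naturals). [folklore] -/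
def padBox (c u s : ℕ) : ℕ × ℕ :=
  if s < 5 then ((boxColRow 1 (c + 1) (u + 3) s).1, padRow c (boxColRow 1 (c + 1) (u + 3) s).2)
  else if s < 9 then (zSlotCol c u (s - 5), 0)
  else (padTall c + u * padE4 c + (s - 9), 0)

/-! ## §3 Bookkeeping -/

/-- Numeric facts at `c ≥ 2`. [folklore] -/
theorem pad_sizes {c : ℕ} (hc : 2 ≤ c) :
    4 ≤ 2 ^ c ∧ padD c = 6 * 2 ^ c - 6 ∧ padTall c = 6 * 2 ^ c ∧ padD1 c = 3 * 2 ^ c - 6 ∧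
      padDed c = 18 * 2 ^ c - 24 ∧ padE4 c = 5 * c - 8 := by
  have h4 : 4 ≤ 2 ^ c := by
    calc (4 : ℕ) = 2 ^ 2 := by norm_num
      _ ≤ 2 ^ c := Nat.pow_le_pow_right (by norm_num) hc
  refine ⟨h4, ?_, ?_, ?_, rfl, rfl⟩
  · unfold padD; omega
  · unfold padTall; rw [pow_succ]; ring
  · unfold padD1; omega

/-- The gadget rows of labels `≥ 3` of `gadgetTab 1 (c+1)` are at most `3c`. [folklore] -/
theorem boxColRow_snd_le {c : ℕ} (hc : 1 ≤ c) (u : ℕ) (hu : u + 3 < 3 * (2 ^ (c + 1) - 1))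
    (s : ℕ) (hs : s < 5) :
    (boxColRow 1 (c + 1) (u + 3) s).2 ≤ 3 * c ∧ (boxColRow 1 (c + 1) (u + 3) s).1 < 3 * 2 ^ (c + 1) ∧
      (boxColRow 1 (c + 1) (u + 3) s).2 < colHeight 1 (c + 1) (boxColRow 1 (c + 1) (u + 3) s).1 := by
  have hlt := boxColRow_lt 1 (c + 1) le_rfl (by omega) ⟨u + 3, hu⟩ ⟨s, by omega⟩
  simp only at hlt
  refine ⟨?_, by simpa using hlt.1, hlt.2⟩
  -- the block of label `u + 3` is at least `1`, so its letters sit at positions `≥ 2`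
  have hj : 1 ≤ labBlock (u + 3) := by
    unfold labBlock
    have : 2 ≤ (u + 3) / 3 + 1 := by omega
    calc 1 = Nat.log 2 2 := by norm_num
      _ ≤ Nat.log 2 ((u + 3) / 3 + 1) := Nat.log_mono_right this
  unfold boxColRow
  split_ifs
  · simp only
    have := le_letterPos (c + 1) (labBlock (u + 3)) ((tripleLabNat 1 s)⁻¹ (labLab (u + 3)))
    unfold letterRow; omega
  · simp only
    have := le_letterPos (c + 1) (labBlock (u + 3))
      (pairKind 1 (labLab (u + 3)) (pairIdx 1 (labLab (u + 3)) (s - 3 * 1)))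
    unfold letterRow; omega

/-- `topPow v ≤ v + 2`, and `topPow v ≤ 2^{c-1}` when `v + 2 < 2^c`. [folklore] -/
theorem topPow_le (v : ℕ) : topPow v ≤ v + 2 :=
  Nat.pow_log_le_self 2 (by omega)

/-- `2 · topPow v ≤ 2^c` when `v + 2 < 2^c`. [folklore] -/
theorem two_mul_topPow_le {c v : ℕ} (hv : v + 2 < 2 ^ c) : 2 * topPow v ≤ 2 ^ c := by
  unfold topPow
  have hc : c ≠ 0 := by rintro rfl; simp at hv
  have hlog : Nat.log 2 (v + 2) < c := (Nat.log_lt_iff_lt_pow (by norm_num) (by omega)).mpr hv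
  calc 2 * 2 ^ Nat.log 2 (v + 2) = 2 ^ (Nat.log 2 (v + 2) + 1) := by rw [pow_succ]; ring
    _ ≤ 2 ^ c := Nat.pow_le_pow_right (by norm_num) (by omega)

/-- The `z`-slot columns lie in the diagram. [folklore] -/
theorem zSlotCol_lt {c : ℕ} (hc : 2 ≤ c) {u i : ℕ} (hu : u < padD c) (hi : i < 4) :
    zSlotCol c u i < padC c := by
  obtain ⟨h4, hD, hT, hD1, hDed, hE4⟩ := pad_sizes hc
  unfold zSlotCol padC
  split_ifs with h0 h1 h2 h3
  · -- first strict top: `q = v + 2 + 2^{j+1} < 2^{c+1}`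
    have hv : u / 3 + 2 < 2 ^ c := by rw [hD1] at h0; omega
    have hP := two_mul_topPow_le hv
    have hcol : 3 * (u / 3 + 2 + topPow (u / 3)) + u % 3 < padTall c := by rw [hT]; omega
    omega
  · have hv : u / 3 + 2 < 2 ^ c := by rw [hD1] at h1; omega
    have hP := two_mul_topPow_le hv
    have hcol : 3 * (u / 3 + 2 + 2 * topPow (u / 3)) + u % 3 < padTall c := by rw [hT]; omega
    omega
  · omega
  · omega
  · -- dedicated singleton
    have hded : dedIdx c u i < padDed c := by
      unfold dedIdx
      split_ifs with hu1
      · push Not at h0 h1 h2 h3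
        have hu6 : 6 ≤ u := by
          interval_cases i
          · exact absurd (h0 rfl) (not_le.mpr hu1)
          · exact absurd (h1 rfl) (not_le.mpr hu1)
          · exact h2 rfl
          · exact h3 rfl
        have hi2 : 2 ≤ i := by
          interval_cases i
          · exact absurd (h0 rfl) (not_le.mpr hu1)
          · exact absurd (h1 rfl) (not_le.mpr hu1)
          · exact le_rfl
          · norm_num
        omega
      · omega
    omega

/-- **The box map lands in the diagram** (column `< padC c`, row `<` height). [folklore] -/
theorem padBox_lt (c : ℕ) (hc : 2 ≤ c) {u s : ℕ} (hu : u < padD c) (hs : s < 5 * c + 1) :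
    (padBox c u s).1 < padC c ∧ (padBox c u s).2 < padHeight c (padBox c u s).1 := by
  obtain ⟨h4, hD, hT, hD1, hDed, hE4⟩ := pad_sizes hc
  have hTC : padTall c ≤ padC c := by unfold padC; omega
  -- every column has positive height
  have hpos : ∀ n, 0 < padHeight c n := by
    intro n
    unfold padHeight
    split_ifs with hn hq
    · omega
    · have hq' : n / 3 < 2 ^ (c + 1) := by
        rw [Nat.div_lt_iff_lt_mul (by norm_num)]; unfold padTall at hn; omega
      have hlog : Nat.log 2 (n / 3) < c + 1 :=
        (Nat.log_lt_iff_lt_pow (by norm_num) (by omega)).mpr hq'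
      omega
    · omega
  unfold padBox
  split_ifs with h5 h9
  · -- gadget box of `gadgetTab 1 (c+1)`, label `u + 3`
    have h2c : 2 ^ (c + 1) = 2 * 2 ^ c := by rw [pow_succ]; ring
    have hu3 : u + 3 < 3 * (2 ^ (c + 1) - 1) := by rw [h2c]; rw [hD] at hu; omega
    obtain ⟨hr, hcol, hlt⟩ := boxColRow_snd_le (c := c) (by omega) u hu3 s h5
    set n := (boxColRow 1 (c + 1) (u + 3) s).1 with hn
    set r := (boxColRow 1 (c + 1) (u + 3) s).2 with hr'
    have hnT : n < padTall c := by rw [hT]; rw [h2c] at hcol; omega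
    refine ⟨lt_of_lt_of_le hnT hTC, ?_⟩
    simp only
    unfold padHeight
    rw [if_pos hnT]
    unfold colHeight at hlt
    unfold padRow
    by_cases hn3 : n < 3
    · rw [if_pos (show n < 3 * 1 by omega)] at hlt
      have hq : n / 3 < 2 := by rw [Nat.div_lt_iff_lt_mul (by norm_num)]; omega
      rw [if_pos hq]
      split_ifs <;> omega
    · rw [if_neg (show ¬ n < 3 * 1 by omega)] at hlt
      have h31 : n / (3 * 1) = n / 3 := by norm_num
      rw [h31] at hlt
      split_ifs <;> omega
  · -- a `z`-slot
    refine ⟨zSlotCol_lt hc hu (by omega), ?_⟩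
    exact hpos _
  · -- main singleton pool
    simp only
    refine ⟨?_, hpos _⟩
    have hE : s - 9 < padE4 c := by rw [hE4]; omega
    have h1 : u * padE4 c + (s - 9) < padD c * padE4 c := by
      have := Nat.mul_le_mul_right (padE4 c) (Nat.succ_le_of_lt hu)
      rw [Nat.succ_mul] at this
      omega
    unfold padC; omega

/-! ## §4 The datum -/

variable {σ : Type*}

/-- **The padded gadget tableau datum** (`k = 1`, `c ≥ 2`) on an enumeration `x : ℕ → σ` of the letters
(largest first: `x 0 = z`, then the `3c` gadget letters). [folklore] -/
def paddedTab (c : ℕ) (hc : 2 ≤ c) (x : ℕ → σ) : TabM σ where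
  C := padC c
  d := padD c
  m := 5 * c + 1
  h n := padHeight c n
  var _ r := x r
  box u s := ⟨⟨(padBox c u s).1, (padBox_lt c hc u.isLt s.isLt).1⟩,
    ⟨(padBox c u s).2, (padBox_lt c hc u.isLt s.isLt).2⟩⟩

/-! ## §5 Heights -/

/-- Heights are at most `3c + 1`. [folklore] -/
theorem padHeight_le (c n : ℕ) : padHeight c n ≤ 3 * c + 1 := by
  unfold padHeight
  split_ifs with h1 h2
  · exact le_rfl
  · have : 0 < Nat.log 2 (n / 3) := Nat.log_pos (by norm_num) (by omega)
    omega
  · omega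

/-- Row `0` (the letter `z`) lies in every column. [folklore] -/
theorem padHeight_pos (c n : ℕ) : 0 < padHeight c n := by
  unfold padHeight
  split_ifs with h1 h2
  · omega
  · have hq' : n / 3 < 2 ^ (c + 1) := by
      rw [Nat.div_lt_iff_lt_mul (by norm_num)]; unfold padTall at h1; omega
    have hlog : Nat.log 2 (n / 3) < c + 1 :=
      (Nat.log_lt_iff_lt_pow (by norm_num) (by omega)).mpr hq'
    omega
  · omega

/-- Row `1` (the letter `A'_{c-1}`) lies exactly in the tall columns. [folklore] -/
theorem one_lt_padHeight_iff {c : ℕ} (hc : 1 ≤ c) (n : ℕ) : 1 < padHeight c n ↔ n < padTall c := by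
  unfold padHeight
  split_ifs with h1 h2
  · simp only [h1, iff_true]; omega
  · simp only [h1, iff_true]
    have hq' : n / 3 < 2 ^ (c + 1) := by
      rw [Nat.div_lt_iff_lt_mul (by norm_num)]; unfold padTall at h1; omega
    have hlog : Nat.log 2 (n / 3) < c + 1 :=
      (Nat.log_lt_iff_lt_pow (by norm_num) (by omega)).mpr hq'
    omega
  · simp only [h1, iff_false]; omega

/-- The tall columns are a proper part of the columns (`c ≥ 2`): the weight of the padded tableau is
nonconstant (row `0` is crossed by all `padC c` columns, row `1` by `padTall c < padC c`). [folklore] -/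
theorem padTall_lt_padC {c : ℕ} (hc : 2 ≤ c) : padTall c < padC c := by
  obtain ⟨h4, hD, hT, hD1, hDed, hE4⟩ := pad_sizes hc
  unfold padC; omega

end

end Summit.ValiantsHypothesis.ValiantsHypothesis.Theorems.GeneratorObstructions.PerGenDegreeSuperQP
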